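import Summits.QuantumFields.YangMills.Theses.BalabanLadder

/-!
# Crux `IR` (item stmt-QuantumFields-19354, route-QuantumFields-BalabanLadder) — vocabulary of the merged line
«maximal correlation at one physical thickness» (`shell-maxcorr-doubling` + the E-seam of `collar-decoupling`)

Helper module for item `stmt-QuantumFields-19354` (`--supports … --as helper`; it closes nothing).  Route-posited
objects of the REGISTERED skeleton `Cruxes/IR/Lines/shell_maxcorr_doubling.lean` (ideator ym-ir-idea-1, merged by
director-ym R363 with ideator ym-ir-idea-5's `Lines/collar_decoupling.lean` E-seam; lead prover ym-ir-line-mxc-p1), made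
tree constants so that every registered stub (`ShellMaxCorr.stub_shellEngine : ShellEngine`,
`ShellMaxCorr.stub_shellRung : ShellRung`, `CollarDecoupling.stub_collarCriterion : CollarCriterion`, and the unstaffed load
`ShellMaxCorr.stub_shellCert : IRShellCorr`) can be closed by a `Theorems/` file proving a constant of THIS module BY NAME, and
so that the skeleton re-bases on `import …Theorems.IR.ShellMaxCorrDefs`.  NOTHING here is asserted: every `def … : Prop` is a
line statement that a registered stub proves or consumes; none is a literature fact; none restates the crux as a claim
(`IRShellCorr` is STRONGER than the crux and carries the whole price — see its docstring).

Deltas against the ideator's skeleton bytes (hygiene, reviewed here; the skeleton is re-registered on these constants):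
(1) Mathlib's `DependsOn f {e | InBall R e}` replaces the skeleton's private `DependsOn` predicate; (2) Mathlib's covariance /
variance `cov[f, g; μ]`, `Var[f; μ]` (`Mathlib.Probability.Moments.Covariance`) replace the skeleton's private `cov`;
(3) the torus sup-distance is written with `ZMod.valMinAbs` (as in the collar line's `cubeSites`) and the far endpoint of a
link with the tree's `Site.shift`; (4) the composition is given in hypotheses form `ir_of_shell : ShellEngine → IRShellCorr → IR`
(real proof, no `sorry`); (5) the rung `ShellRung` is stated for compact METRISABLE `G` (`[T2Space G] [SecondCountableTopology G]`,
the setting of OS78 and of the tree's S14 restatement), the other statements get second countability from `r : LatticeRep G`;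
the stubs themselves are NOT here.

## Contents
* §0 (collar line, namespace `…Cruxes.IR.CollarDecoupling`, verbatim from `Lines/collar_decoupling.lean` c706ce9c9222):
  `cubeSites`, `cubeEdges`, `IsCubeLocal`, `IsExteriorLocal`, the collar format `CollarDecouplingAt`, the E-seam statement
  `CollarCriterion`.
* §1 (shell line, namespace `…Cruxes.IR.ShellMaxCorr`) torus geometry: `siteNorm`, `InBall`, `OutBall`.
* §2 the shell maximal-correlation bound `ShellCorrBound` (Hirschfeld–Gebelein–Rényi coefficient between the links of the
  sup-ball `B_R` and the links outside `B_{R+s}` under the torus Wilson state is `≤ θ`), `ShellCert`, `ShellCertificate`.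
* §3 the three statements `ShellEngine` (engine: certificate ⇒ `GapInUnits`, group-blind), `IRShellCorr` (the load),
  `ShellRung` (strong-coupling rung), and the kernel-checked composition `ir_of_shell`.

HONEST FRAMING: vocabulary and bookkeeping for ONE open gap-crux of a CONDITIONAL chain (R4 closes only the finite-𝕋⁴ UV rung
`BalabanLadder.UV`); the Props are hypotheses; nothing here proves weak-coupling decoupling, a lattice mass gap, or the
Clay Yang–Mills problem.

Refs: line cards `Cruxes/IR/Lines/shell-maxcorr-doubling.md`, `Cruxes/IR/Lines/collar-decoupling.md`; critics
`pub/ym-ir/ym-ir-crit-2/VERDICT-maxcorr-pair.md`; Markov machinery `Literature/MathematicalPhysics/QuantumLattice/TorusWilsonGibbs.lean`,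
`…/TorusWilsonMarkov.lean`; Bradley, *Basic properties of strong mixing conditions* (2005) §1 (ρ-mixing, maximal correlation).
-/

set_option autoImplicit false

noncomputable section

open Filter Topology MeasureTheory ProbabilityTheory
open Literature.MathematicalPhysics.QuantumFieldTheory Literature.MathematicalPhysics.QuantumLattice
open Summit.QuantumFields.YangMills.Cruxes.OSLegsFromFemtoAndGap.DlrCollarTransfer (GapInUnits LowerBounds)

/-! ## §0 The collar line's vocabulary and E-seam statement (verbatim from `Lines/collar_decoupling.lean`) -/

namespace Summit.QuantumFields.YangMills.Cruxes.IR.CollarDecoupling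

/-- Sites of the odd torus `(ℤ/(2S+1))⁴` within sup-distance `R` of the centre `c` (torus distance via `valMinAbs`). -/
def cubeSites (S : ℕ) (c : Site 4 (2 * S + 1)) (R : ℕ) : Set (Site 4 (2 * S + 1)) :=
  {x | ∀ i, ((x i - c i).valMinAbs).natAbs ≤ R}

/-- Edges of the torus based at a site of the cube `Λ_R(c)`. -/
def cubeEdges (S : ℕ) (c : Site 4 (2 * S + 1)) (R : ℕ) : Set (Edge 4 (2 * S + 1)) :=
  {e | e.1 ∈ cubeSites S c R}

variable {G : Type} [Group G] [TopologicalSpace G] [IsTopologicalGroup G] [CompactSpace G]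
  [MeasurableSpace G] [BorelSpace G]

/-- A bounded measurable torus statistic depending only on the links based in `Λ_R(c)`. -/
def IsCubeLocal (S : ℕ) (c : Site 4 (2 * S + 1)) (R : ℕ) (f : GaugeConfig 4 (2 * S + 1) G → ℝ) : Prop :=
  Measurable f ∧ (∃ M : ℝ, ∀ V, |f V| ≤ M) ∧ DependsOn f (cubeEdges S c R)

/-- A bounded measurable torus statistic depending only on the links based OUTSIDE `Λ_R(c)`. -/
def IsExteriorLocal (S : ℕ) (c : Site 4 (2 * S + 1)) (R : ℕ) (h : GaugeConfig 4 (2 * S + 1) G → ℝ) : Prop :=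
  Measurable h ∧ (∃ M : ℝ, ∀ V, |h V| ≤ M) ∧ DependsOn h (cubeEdges S c R)ᶜ

/-- **Collar decoupling at mesh `b`** (the format of the collar line).  On every odd torus `(2S+1)⁴`, for every cube
`Λ_R(c)` with `R + b + 2 ≤ S` and every cube-local bounded statistic `f` there is a surrogate `f'`, local in `Λ_{R+b+2}(c)`,
with (a) `∫ (f − f')·h dμ = 0` for every bounded statistic `h` of the exterior of `Λ_{R+b}(c)` (so `f'` may replace `f`
against the far field, and `∫ f' = ∫ f`), and (c) `Var_μ f' ≤ ¼ Var_μ f` — the Hirschfeld–Gebelein–Rényi maximal correlation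
between `Λ_R(c)` and the exterior of `Λ_{R+b}(c)` under `μ = wilsonMeasure ρ β` is at most `½`.  (The conditional
expectation `E_μ[f | exterior]` is the intended witness: (a) by definition, locality by the Markov property of the plaquette
action, (c) the content.) -/
def CollarDecouplingAt {N : ℕ} (ρ : G →* Matrix (Fin N) (Fin N) ℂ) (β : ℝ) (b : ℕ) : Prop :=
  ∀ (S : ℕ) (c : Site 4 (2 * S + 1)) (R : ℕ), R + b + 2 ≤ S →
    ∀ f : GaugeConfig 4 (2 * S + 1) G → ℝ, IsCubeLocal S c R f →
      ∃ f' : GaugeConfig 4 (2 * S + 1) G → ℝ, IsCubeLocal S c (R + b + 2) f' ∧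
        (∀ h : GaugeConfig 4 (2 * S + 1) G → ℝ, IsExteriorLocal S c (R + b) h →
          ∫ V, (f V - f' V) * h V ∂(wilsonMeasure (d := 4) (L := 2 * S + 1) ρ β) = 0) ∧
        ∫ V, (f' V - ∫ W, f W ∂(wilsonMeasure (d := 4) (L := 2 * S + 1) ρ β)) ^ 2
            ∂(wilsonMeasure (d := 4) (L := 2 * S + 1) ρ β) ≤
          (1 / 4) * ∫ V, (f V - ∫ W, f W ∂(wilsonMeasure (d := 4) (L := 2 * S + 1) ρ β)) ^ 2
            ∂(wilsonMeasure (d := 4) (L := 2 * S + 1) ρ β)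

/-- **E-seam of the collar line (criterion): collar decoupling at mesh `b` ⇒ clustering at rate `κ / b`**, constants
uniform in `β, b, S` — the shape of `AfPincerUc.FmtClustering`, universally over `(G, ρ)`.  Nested-collar
submultiplicativity of maximal correlation + Cauchy–Schwarz; no Yang–Mills input beyond finite range. -/
def CollarCriterion : Prop :=
  ∃ (κ : ℝ) (s₀ : ℕ), 0 < κ ∧
    ∀ (G : Type) [Group G] [TopologicalSpace G] [IsTopologicalGroup G] [CompactSpace G] [MeasurableSpace G] [BorelSpace G]
      (N : ℕ) (ρ : G →* Matrix (Fin N) (Fin N) ℂ), Continuous ρ →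
      ∀ A B : LocalGaugeObservable 4 G, ∃ C : ℝ,
        ∀ (β : ℝ) (b : ℕ), 1 ≤ b → CollarDecouplingAt ρ β b →
          ∀ S : ℕ, s₀ * b ≤ 2 * S + 1 → ∀ t : ℕ, t ≤ S →
            |latticeConnectedCorr ρ β (2 * S + 1) A.F B.F t| ≤ C * Real.exp (-(κ * t / b))

end Summit.QuantumFields.YangMills.Cruxes.IR.CollarDecoupling

namespace Summit.QuantumFields.YangMills.Cruxes.IR.ShellMaxCorr

/-! ## §1 Torus geometry: sup-distance from the origin, inner balls and outer regions of links -/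

/-- Sup-distance of a torus site from the origin: `max_k |x_k|` with `|·|` the distance from `0` on the cycle `ℤ/N`
(`ZMod.valMinAbs`, i.e. `min (z.val) (N - z.val)`). -/
def siteNorm {N : ℕ} (x : Site 4 N) : ℕ := Finset.univ.sup fun k => ((x k).valMinAbs).natAbs

/-- Links of the closed sup-ball of radius `t` about the origin: both endpoints `x`, `x + e_k` at distance `≤ t`. -/
def InBall {N : ℕ} (t : ℕ) (e : Edge 4 N) : Prop := siteNorm e.1 ≤ t ∧ siteNorm (e.1.shift e.2) ≤ t

/-- Links outside the open sup-ball of radius `t`: both endpoints at distance `≥ t`.  (A link of the sphere layer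
`{both endpoints at distance exactly t}` is both `InBall t` and `OutBall t`; every link is one or the other.) -/
def OutBall {N : ℕ} (t : ℕ) (e : Edge 4 N) : Prop := t ≤ siteNorm e.1 ∧ t ≤ siteNorm (e.1.shift e.2)

/-! ## §2 The shell maximal-correlation bound under the torus Wilson measure -/

section Measure

variable {G : Type} [Group G] [TopologicalSpace G] [IsTopologicalGroup G] [CompactSpace G]
  [MeasurableSpace G] [BorelSpace G]

/-- **Shell correlation bound** `ShellCorrBound ρ β N R s θ`: on the torus of side `N`, every bounded measurable `f`
depending only on the links of the ball `B_R` and every bounded measurable `g` depending only on the links outside `B_{R+s}`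
satisfy `|Cov(f,g)| ≤ θ·σ(f)·σ(g)` under the Wilson measure `μ = wilsonMeasure ρ β` (Mathlib `cov[f, g; μ]`, `Var[f; μ]`),
i.e. the Hirschfeld–Gebelein–Rényi maximal correlation between the two link σ-algebras is `≤ θ` (bounded functions are
dense in `L²`).  Sign-free (no positivity / association is used). -/
def ShellCorrBound {n : ℕ} (ρ : G →* Matrix (Fin n) (Fin n) ℂ) (β : ℝ) (N : ℕ) [NeZero N]
    (R s : ℕ) (θ : ℝ) : Prop :=
  ∀ f g : GaugeConfig 4 N G → ℝ, Measurable f → Measurable g →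
    (∃ C, ∀ U, |f U| ≤ C) → (∃ C, ∀ U, |g U| ≤ C) →
    DependsOn f {e | InBall R e} → DependsOn g {e | OutBall (R + s) e} →
      |cov[f, g; wilsonMeasure (d := 4) (L := N) ρ β]|
        ≤ θ * Real.sqrt (Var[f; wilsonMeasure (d := 4) (L := N) ρ β])
            * Real.sqrt (Var[g; wilsonMeasure (d := 4) (L := N) ρ β])

/-- `Ψ_β(s) ≤ θ` on the torus of side `2S+1`: the shell bound at thickness `s` for EVERY inner radius `R` (the `sup` over
`R` is what makes the doubling law `Ψ(2s+1) ≤ Ψ(s)²` close). -/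
def ShellCert {n : ℕ} (ρ : G →* Matrix (Fin n) (Fin n) ℂ) (β : ℝ) (S s : ℕ) (θ : ℝ) : Prop :=
  ∀ R : ℕ, ShellCorrBound ρ β (2 * S + 1) R s θ

/-- **The certificate in physical units.**  At ONE physical shell thickness `K₀` (lattice thickness `⌈K₀ / a β⌉₊`) the
shell maximal correlation is bounded by some `θ < 1`, for all large `β` and all large tori. -/
def ShellCertificate (r : LatticeRep G) (a : ℝ → ℝ) : Prop :=
  ∃ (K₀ θ β₂ : ℝ) (S₁ : ℝ → ℕ), 0 < K₀ ∧ 0 ≤ θ ∧ θ < 1 ∧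
    ∀ β : ℝ, β₂ ≤ β → ∀ S : ℕ, S₁ β ≤ S → ShellCert r.ρ β S ⌈K₀ / a β⌉₊ θ

end Measure

/-! ## §3 The three statements of the line and the composition -/

/-- **ENGINE (registered stub `stub_shellEngine`, size M; the annulus-gluing transfer, group-blind).**  The Markov
property of the Wilson plaquette action across one link layer and the Hilbert-space product bound
`ρ(𝒜,𝒞) ≤ ρ(𝒜,ℳ)·ρ(ℳ,𝒞)` give the doubling law `Ψ(2s+1) ≤ Ψ(s)²`; iterating from `Ψ(s₀) ≤ θ`,
`Ψ(t) ≤ θ^{(t+1)/(2s₀+2)}`; with `s₀ = ⌈K₀/a β⌉` and `|Cov(A, τ_n B)| ≤ ‖A‖‖B‖ Ψ(n − r_A − r_B)` this is `GapInUnits`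
(rate `∝ |log θ| / K₀`).  No simplicity of `G`, no smallness of `θ` beyond `θ < 1`. -/
def ShellEngine : Prop :=
  ∀ (G : Type) [Group G] [TopologicalSpace G] [IsTopologicalGroup G] [CompactSpace G],
    letI : MeasurableSpace G := borel G; haveI : BorelSpace G := ⟨rfl⟩;
    ∀ (r : LatticeRep G) (a : ℝ → ℝ), (∀ β, 0 < a β) → Tendsto a atTop (𝓝 0) →
      ShellCertificate r a → GapInUnits G r a

/-- **THE LOAD of the line (registered stub `stub_shellCert`, size XL — NOT staffed; it is the weak-coupling mass gap in
maximal-correlation clothes, one level STRONGER than `GapInUnits`).**  For compact SIMPLE `G`, non-triviality in units `a`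
(`LowerBounds`) forces, at some physical thickness `K₀`, shell maximal correlation `≤ θ < 1` uniformly in the inner radius,
for all large `β` and tori.  Simplicity is load-bearing: with a `U(1)` factor the massless photon gives sphere-averaged modes
with `1 − Ψ(s)² ≍ s/R → 0`, so the certificate is FALSE at `U(1)×SU(2)` (`Literature.Barriers.QuantumFields.AbelianDeconfinementD4`). -/
def IRShellCorr : Prop :=
  ∀ (G : Type) [Group G] [TopologicalSpace G] [IsTopologicalGroup G] [CompactSpace G],
    IsCompactSimpleLieGroup G → letI : MeasurableSpace G := borel G; haveI : BorelSpace G := ⟨rfl⟩;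
    ∀ (r : LatticeRep G) (a : ℝ → ℝ), (∀ β, 0 < a β) → Tendsto a atTop (𝓝 0) →
      LowerBounds G r a → ShellCertificate r a

/-- **RUNG (registered stub `stub_shellRung`; strong coupling, thickness ONE lattice layer, uniform in the radius and the
volume).**  For a compact metrisable gauge group (compact Hausdorff second countable — the setting of Osterwalder–Seiler
1978 and of the tree's S14 restatement `osterwalder_seiler_strongCoupling_secondCountable`; without it the product σ-algebra
of the links is not the Borel one and the Wilson density is not known to be measurable) and a continuous representation
`ρ`: for `|β| ≤ β₀(ρ)` the shell maximal correlation across a single layer is `≤ 1/2` for every radius and every odd torus —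
the format's first rung outside the trivial point `β = 0` (where `Ψ ≡ 0`).  Route to a proof: high-temperature ρ-mixing of a
finite-range Gibbs field uniformly in the set sizes (Dobrushin influence per layer link, localised by the Markov layer). -/
def ShellRung : Prop :=
  ∀ (G : Type) [Group G] [TopologicalSpace G] [IsTopologicalGroup G] [CompactSpace G] [T2Space G]
    [SecondCountableTopology G] [MeasurableSpace G] [BorelSpace G] (n : ℕ) (ρ : G →* Matrix (Fin n) (Fin n) ℂ),
    Continuous ρ →
    ∃ β₀ : ℝ, 0 < β₀ ∧ ∀ β : ℝ, |β| ≤ β₀ → ∀ S R : ℕ, ShellCorrBound ρ β (2 * S + 1) R 1 (1 / 2)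

/-- **Composition (real proof, hypotheses form): engine + load ⇒ the route decl `BalabanLadder.IR` BY NAME.**  The
registered skeleton's `IR_of` is `ir_of_shell stub_shellEngine stub_shellCert`. -/
theorem ir_of_shell (hE : ShellEngine) (hC : IRShellCorr) :
    Summit.QuantumFields.YangMills.Theses.BalabanLadder.IR := by
  delta Summit.QuantumFields.YangMills.Theses.BalabanLadder.IR
  intro G _ _ _ _ hG
  letI : MeasurableSpace G := borel G
  haveI : BorelSpace G := ⟨rfl⟩
  intro r a ha ha0 hlb
  exact hE G r a ha ha0 (hC G hG r a ha ha0 hlb)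

end Summit.QuantumFields.YangMills.Cruxes.IR.ShellMaxCorr

end
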